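import Literature.NumberTheory.Automorphic.Liu2021.AppendixC.DefC1toC3
import Literature.NumberTheory.Automorphic.Liu2021.Def411AsPrinted
import Literature.NumberTheory.Automorphic.IdeleClassCharacterAlgebraicTwist
import Literature.NumberTheory.GaloisRepresentations.CMTypeHeckeCharacter
import Literature.NumberTheory.GaloisRepresentations.WeilLAdicCharacterLocalShape
import Literature.NumberTheory.NumberFields.IdelicArtinMap
import Literature.AlgebraicGeometry.Motives.AbelianVarietyProduct
import Literature.AlgebraicGeometry.Motives.AbelianVarietyConjugate
import Literature.AlgebraicGeometry.Motives.Jacobian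
import Mathlib.RepresentationTheory.Intertwining
import Mathlib.RepresentationTheory.Irreducible
import Literature.NumberTheory.GaloisRepresentations.AbsGaloisGroup
import Mathlib.NumberTheory.Padics.Complex
import HarnessLib

/-!
# Liu 2021, Appendix D §D.3 «Statements for cohomology of unitary Shimura curves» — Definition D.3, Proposition D.4,
# Remark D.5, the `ℓ`-adic set-up, Theorem D.6, display (D.3), Corollary D.7, EXACTLY AS PRINTED
# (statement-exact typing over a posited §D.3 datum; NO proof of any result of [Liu2021]; §D.4 = sibling `SecD4ProofOfThmD6`)

[Liu2021] = Yifeng Liu, *Fourier–Jacobi cycles and arithmetic relative trace formula* (with an appendix by Chao Li and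
Yihang Zhu), Cambridge J. Math. **9** (2021), no. 1, 1–147 = arXiv:2102.11518.  SOURCES READ FOR THIS FILE: (i) the PRINT,
held as `paper:liu2021-fourier-jacobi-cycles-arithmetic-relative-trace-formula` (page file `pNNNN` = journal page `N`; every
«p. N Lk» below is line `k` of that page file): §D.3 opens p. 129 L37, Def. D.3 p. 130 L27, Prop. D.4 p. 130 L47, Rem. D.5
p. 131 L35, the `ℓ`-adic set-up pp. 131–132, Thm. D.6 p. 132 L22, the Albanese paragraph and display (D.3) p. 133, Cor. D.7
p. 133 L59, §D.4 opens p. 134 L18, Prop. D.8 p. 135 L5, Cor. D.9 p. 138 L44, proof of Thm. D.6 p. 139 – p. 140 L45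
(concordance `lit/PAGE-CONCORDANCE-Liu2021.md` of the cell hodgecm-mathlib); (ii) the author's TeX source of the arXiv
e-print, `FJcycle.tex` (md5 `6db49a74122d2cb0f224fa1b39488a0c`; every «l. NNNN» is a line of that file): App. D =
`\section{Cohomology of unitary Shimura curves}` l. 5201, §D.3 = `\subsection{Statements …}` l. 5350 (label
`ss:statements_curve`), §D.4 = l. 5497 (label `ss:proof_curve`); Def. D.3 = `de:cohomological_curve` l. 5365–5373,
Prop. D.4 = `pr:endoscopic_curve` l. 5376–5383, Rem. D.5 = `re:galois_curve` l. 5396–5405, Thm. D.6 = `th:galois_curve`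
l. 5433–5459, (D.3) = `eq:endoscopic_albanese` l. 5464–5466, Cor. D.7 = the unlabelled corollary l. 5486–5492, Prop. D.8 =
`pr:congruence` l. 5522–5540, Cor. D.9 = `co:congruence` l. 5579–5585.  Print and TeX agree word for word on every sentence
typed here (checked; the print writes [Liu11b], [DR73, KM85], [YZZ13] for the TeX's `\cite{Liu12}`, `\cites{DR72,KM85}`, `\cite{YZZ}`).

This is the SECTION CARPET of App. D §D.3 (cell hodgecm-mathlib, squad TL «Liu FJ∕418», seat TL-t07; deal sheet
`T/LIU/TL-plan/g0/SPLIT-TL.v1`): every numbered item of the two subsections is typed as a `Prop`-valued PREDICATE on a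
posited datum, in the style — and on top — of the sibling statement-exact records `AppendixC.DefC1toC3` (App. C §C.1:
`HermSpace`, `HermSpace.ShimuraSystem`), `Def411AsPrinted`, `Thm418AsPrinted`, `LemD1AsPrinted`, `LemD2AsPrinted`.
**NOTHING IS ASSERTED**: no declaration below has a closed statement of [Liu2021] as its type; a consumer takes
`(h : D.Liu2021_D4_1)` etc. for ITS OWN datum `D`.  0 new named facts (no `def X : Prop` without arguments), no `sorry`,
no `axiom`, no `instance` and no instance attribute (posited vector spaces are bundled as Mathlib `ModuleCat` objects, as in
the sibling `SecD1D2OscillatorSetup`), no notation.  DEDUP: Lemma D.1 and Lemma D.2 (§D.1) are the records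
`LemD1AsPrinted` / `LemD2AsPrinted` of the parent directory and are only CITED here; the kernel-side files
`RemD5SignSelectors`/`RemD5Companion*`, `AppendixC/ThmD6CompositionGeneric`, `AppendixC/RecordCurveCorD9OfEichlerShimura`,
`RecordCurveEichlerShimura`, `Rogawski1990/CurveCohomologicalSpectrum` prove compositions AROUND Rem. D.5 / Thm. D.6 (1) /
Cor. D.9 in the cell's pinned currency and, by their own words, assert no printed text — they are not duplicated by, and
do not duplicate, the present AS-PRINTED sentences.

## The printed text (verbatim; TeX macros resolved: `\rG` = `G`, `\rV` = `V`, `\rh` = `h`, `\bA` = `𝔸`, `\dC` = `ℂ`,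
`\dQ` = `ℚ`, `\tc` = `c`, `\ol\Sh` = `S̄h`, `\rH` = `H`, `\rB` = `B`, `\et` = `ét`, `\fg` = `𝔤`, `\rK` = `K`, `\fq` = `𝔮`, `\fp` = `𝔭`)

**§D.3, standing data** (l. 5353–5363; p. 129 L39 – p. 130 L26): «We fix a CM number field `E` and regard `E` as a subfield
of `ℂ` via a fixed complex embedding `τ'₁ : E ↪ ℂ`. Let `c ∈ Gal(E/ℚ)` be the induced complex conjugation and put
`F := E^{c=1}`. Write `Φ_F = {τ₁, …, τ_d}` with `d = [F:ℚ]` as the set of real embeddings of `F`, in which `τ₁` is the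
restriction of `τ'₁`.  Let `V` be a hermitian space over `E` of rank `2` of signature `(1,1)` at `τ₁` and `(2,0)` elsewhere.
As in Subsection C.1 especially Remark C.2, we have the Hodge map `h := h_{V,τ'₁}`, the Shimura varieties `{Sh(G,h)_K}`
defined over `E`, and their Baily–Borel compactification `S̄h(G,h)_K`, all of which are smooth curves over `E`. By the
discussion from Subsection D.2, we have an isomorphism  `H¹_B(S̄h(G,h), ℂ) ≃ ⊕_π m_disc(π) H¹(𝔤, K_G; π_∞) ⊗ π^∞`  of
`G(𝔸^∞)`-modules, where `H¹_B(S̄h(G,h), ℂ) := lim_K H¹_B(S̄h(G,h)_K, ℂ)`. By Lemma D.2, up to equivalence, there are only two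
representations `π_∞` of `G(ℝ)` with `H¹(𝔤, K_G; π_∞) ≠ {0}`, namely `π_∞^{(1,0)} := π_{1,1}^{1,0} ⊗ 1 ⊗ ⋯ ⊗ 1`,
`π_∞^{(0,1)} := π_{1,1}^{0,1} ⊗ 1 ⊗ ⋯ ⊗ 1`.»

**DEFINITION D.3** (l. 5365–5373; p. 130 L27–46): «Let `π^∞` be an irreducible admissible representation of `G(𝔸^∞)`.
 • We say that `π^∞` is *stable cohomological* if both `π_∞^{(1,0)} ⊗ π^∞` and `π_∞^{(0,1)} ⊗ π^∞` have positive cuspidal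
   multiplicity.
 • We say that `π^∞` is *endoscopic cohomological* if exactly one of `π_∞^{(1,0)} ⊗ π^∞` and `π_∞^{(0,1)} ⊗ π^∞` has
   positive cuspidal multiplicity.
Denote `𝒞_V^{st}` (resp. `𝒞_V^{end}`) the set of isomorphism classes of stable (resp. endoscopic) cohomological irreducible
admissible representations of `G(𝔸^∞)`. Put `𝒞_V := 𝒞_V^{st} ∐ 𝒞_V^{end}`.»

**PROPOSITION D.4** (l. 5376–5383; p. 130 L47–54): «Let `π^∞` be an irreducible admissible representation of `G(𝔸^∞)`.
 (1) If `π^∞` is endoscopic cohomological, then there exists a unique adèlic oscillator triple `(μ, ε, χ)` (Definition 4.11)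
     with `μ` of weight one and satisfying `τ'₁ ∈ Φ_μ`, such that `π^∞` is isomorphic to `ω(μ, ε, χ)`. Moreover,
     `Hom_{ℂ[G(𝔸^∞)]}(π^∞, H¹_B(S̄h(G,h), ℂ))` has dimension `1`.
 (2) If `π^∞` is stable cohomological, then `Hom_{ℂ[G(𝔸^∞)]}(π^∞, H¹_B(S̄h(G,h), ℂ))` has dimension `2`.»
(Proof, l. 5385–5393, NOT formalised: inner transfer `U(V) → U(V*)` [Har93], [Rog90, §11], Arthur's multiplicity formula,
Thm. B.4, Lemma D.1 (4).)

**REMARK D.5** (l. 5396–5405; p. 131 L35–42): «The proof of Proposition D.4(1) implies that for `π^∞ ≃ ω(μ, ε, χ)` that is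
endoscopic cohomological, we have `m_cusp(π_∞^{(1,0)} ⊗ π^∞) = 1` (resp. `m_cusp(π_∞^{(0,1)} ⊗ π^∞) = 1`) if and only if there
exists some `e ∈ E^{×−}` such that
 • `ε_v = e Nm_{E_v/F_v} E_v^×` for every nonarchimedean place `v` of `F`,
 • `τ'_i(e)` has negative imaginary part for `i = 2, …, d`, where `τ'_i` is the unique element in `Φ_μ` above `τ_i`, and
 • `τ'₁(e)` has negative (resp. positive) imaginary part.»

**The `ℓ`-adic set-up** (l. 5408–5426; p. 131 L43 – p. 132 L21): «Take a rational prime `ℓ` and an isomorphism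
`ι_ℓ : ℂ ≃ ℚ_ℓ^{ac}`. Put `H¹_ét(S̄h(G,h), ℚ_ℓ^{ac}) := lim_K H¹_ét(S̄h(G,h)_K ⊗_E ℂ, ℚ_ℓ^{ac})`. By the comparison theorem, we have
a canonical isomorphism `H¹_ét(S̄h(G,h), ℚ_ℓ^{ac}) ≃ H¹_B(S̄h(G,h), ℂ) ⊗_{ℂ,ι_ℓ} ℚ_ℓ^{ac}` of `G(𝔸^∞)`-modules. For an irreducible
admissible representation `π^∞` of `G(𝔸^∞)`, the `ℚ_ℓ^{ac}`-vector space `H¹_{ι_ℓ}(π^∞) := Hom_{ℚ_ℓ^{ac}[G(𝔸^∞)]}(ι_ℓ ∘ π^∞,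
H¹_ét(S̄h(G,h), ℚ_ℓ^{ac}))` is a representation of `Gal(ℂ/E)`, which we denote by `ρ_{ι_ℓ}(π^∞)`.  Suppose that `π^∞` is
endoscopic cohomological. Then by Proposition D.4, we obtain an `ℓ`-adic character `ρ_{ι_ℓ}(π^∞) : Gal(ℂ/E) → (ℚ_ℓ^{ac})^×`.
It induces, via the isomorphism `ι_ℓ`, an automorphic character `ρ_ℓ(π^∞) : E^× \ 𝔸_E^× → ℂ^×`. It is easy to see that the
character `ρ_ℓ(π^∞)` does not depend on the choice of the isomorphism `ι_ℓ`, which justifies its notation.»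

**THEOREM D.6** (l. 5433–5459; p. 132 L22–42): «Let `π^∞` be an irreducible admissible representation of `G(𝔸^∞)`, and `ℓ`
a rational prime.
 (1) Suppose that `π^∞` is endoscopic cohomological, which is isomorphic to `ω(μ, ε, χ)` with `μ` of weight one and
     satisfying `τ'₁ ∈ Φ_μ` as in Theorem [sic; = Proposition] D.4(1). Then
        `ρ_ℓ(π^∞) = μ · | |_E^{−1/2}`            if `m_cusp(π_∞^{(1,0)} ⊗ π^∞) = 1`;
        `ρ_ℓ(π^∞) = μ^c χ̌ · | |_E^{−1/2}`        if `m_cusp(π_∞^{(0,1)} ⊗ π^∞) = 1`.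
 (2) Suppose that `π^∞` is stable cohomological. Then for every `ι_ℓ : ℂ ≃ ℚ_ℓ^{ac}`, we have
     (a) `ρ_{ι_ℓ}(π^∞)` is an irreducible two-dimensional representation of `Gal(ℂ/E)`;
     (b) `ρ_{ι_ℓ}(π^∞)^∨ ≃ ρ_{ι_ℓ}(π^∞)^c(1)`;
     (c) if we let `Π^∞` be the irreducible admissible representation of `GL₂(𝔸_E^∞)` that is the standard base change of
         `π^∞`, then for every nonarchimedean place `w` of `E` coprime to `ℓ`,
         `WD(ρ_{ι_ℓ}(π^∞)|Gal(E_w^{ac}/E_w))^{F-ss} ≃ ι_ℓ ∘ 𝓛_{2,E_w}(Π^∞_w |det|_w^{−1/2})` holds, where `𝓛_{2,E_w}` denotes the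
         local Langlands correspondence for `GL_{2,E_w}`.
 The proof of the theorem will be given in Subsection D.4.»  (`χ̌(x) = χ(x/x^c)`, §D.1 l. 5224.)

**The Albanese paragraph and (D.3)** (l. 5463–5485; p. 133): «The theorem reveals some information about the Albanese variety
(Jacobian) `A_K` of `S̄h(G,h)_K`. We have a homomorphism `𝒞^∞_c(K\𝔾(𝔸^∞)/K, ℚ) → End(A_K)_ℚ` of `ℚ`-algebras induced by the Hecke
actions. Note that `Gal(ℂ/ℚ)` acts on `𝒞_V` through the coefficients, which preserves the two subsets `𝒞_V^{st}` and `𝒞_V^{end}`.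
Therefore, we obtain an isogeny decomposition  (D.3)  `A_K ∼ A_K^{st} × A_K^{end}`  (over `E`) such that under the canonical
isomorphism in Lemma 2.4(1), we have isomorphisms `H¹_B(A_K^{st}, ℂ) ≃ ⊕_{π^∞ ∈ 𝒞_V^{st}} H¹_B(S̄h(G,h)_K, ℂ)[(π^∞)^K]`,
`H¹_B(A_K^{end}, ℂ) ≃ ⊕_{π^∞ ∈ 𝒞_V^{end}} H¹_B(S̄h(G,h)_K, ℂ)[(π^∞)^K]` of `𝒞^∞_c(K\𝔾(𝔸^∞)/K, ℚ)`-modules.  Put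
`𝒞̲_V^{st} := 𝒞_V^{st}/Gal(ℂ/ℚ)`, the set of `Gal(ℂ/ℚ)`-orbits in `𝒞_V^{st}`. For every orbit `π̲^∞`, denote by `M(π̲^∞) ⊆ ℂ` its
field of definition, namely, the fixed field of the stabilizer of `π̲^∞` in `Gal(ℂ/ℚ)`; it is a number field, either totally
real or CM. By Theorem D.6(2) and a standard argument, we may associate to `π̲^∞` a (simple) abelian variety `A(π̲^∞)` over `E`,
which satisfies  • `dim A(π̲^∞) = [M(π̲^∞):ℚ]`,  • `End_E(A(π̲^∞))_ℚ ≃ M(π̲^∞)`, and  • `A(π̲^∞) ⊗_{E,c} E` is isogenous to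
`A(π̲^∞)^∨`.  In fact, `A(π̲^∞)` is of strict `GL(2)`-type in the terminology of [YZZ13, Section 3.2.1]. Finally, note that for
every open compact subgroup `K` of `G(𝔸^∞)`, the dimension of `K`-fixed vectors in a representation in `π̲^∞` depends only on the
orbit, which we denote by `dim_ℂ(π̲^∞)^K`. Theorem D.6(2) has the following corollary.»

**COROLLARY D.7** (l. 5486–5492; p. 133 L59 – p. 134): «For every sufficiently small open compact subgroup `K` of `G(𝔸^∞)`, we
have an isogeny decomposition `A_K^{st} ∼ ∏_{π̲^∞ ∈ 𝒞̲_V^{st}} A(π̲^∞)^{dim_ℂ(π̲^∞)^K}` compatible with changing `K` in the obvious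
way. In particular, `A_K^{st}` does not have factors that are of CM type. Moreover, `A(π̲₁^∞)` is isogenous to `A(π̲₂^∞)` for
`π̲₁^∞, π̲₂^∞ ∈ 𝒞̲_V^{st}` if and only if there exist `π₁^∞ ∈ π̲₁^∞` and `π₂^∞ ∈ π̲₂^∞` that have the same standard base change to
`GL₂(𝔸_E^∞)`.»  (l. 5494: «The isogeny decomposition of `A_K^{end}` is a special case of Corollary 4.20.»)

**§D.4** (standing data l. 5500–5520, Prop. D.8, Cor. D.9, the paragraph l. 5626–5627 of the proof of Thm. D.6 (1)) is typed in
the sibling file `AppendixD.SecD4ProofOfThmD6` over the datum `SecD3Data` of this file (squad TL re-deal 2026-09-02T02:08Z).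

## The typing (paper order; `⟨CARRIER⟩` = posited datum, exactly as in `AppendixC.DefC1toC3` / `Thm418AsPrinted` / `LemD2AsPrinted`)

* THE FIELDS ARE REAL.  «CM number field `E`», «`F := E^{c=1}`»: the pair `(F, E)` with `F` totally real, `E/F` totally
  imaginary quadratic — the instance arguments of `AppendixC.HermSpace` / `Thm418Data` (READING R1 of `AppendixC.DefC1toC3`:
  `c = AppendixC.conj F E` is Mathlib's `IsCMField.complexConj E`, the `IsCMField E` instance being `isCMField F E` of
  `Thm418AsPrinted`); «`τ'₁ : E ↪ ℂ`» is a field `τ₁' : E →+* ℂ`; «`τ₁` the restriction of `τ'₁`» = `AppendixC.restr F E τ₁'`;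
  «`Φ_F`» = `F →+* ℝ`.  «`Gal(ℂ/ℚ)`» = `ℂ ≃ₐ[ℚ] ℂ` (as in `AppendixC.DefC1toC3`, `Thm418AsPrinted`).  READING G1 («`Gal(ℂ/E)`»):
  as in `AppendixC.Thm415Pinned` (module docstring, «GALOIS GROUP»), the representations `ρ_{ι_ℓ}(π^∞)` «of `Gal(ℂ/E)`» are typed
  on Mathlib's absolute Galois group `Γ_E := Field.absoluteGaloisGroup E = Gal(Ē/E)`; the printed `Gal(ℂ/E)` (`E ⊂ ℂ` via
  `τ'₁`) acts on `H¹_ét(S̄h_K ⊗_E ℂ, ℚ_ℓ^{ac})` through its quotient `Gal(Ē/E)` for any extension of `τ'₁` to `Ē`, and Thm. D.6 /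
  Cor. D.9 are statements about that action.
* THE HERMITIAN PLANE AND THE CURVES ARE THE TREE'S.  «`V` a hermitian space over `E` of rank `2` of signature `(1,1)` at `τ₁`
  and `(2,0)` elsewhere» = an `AppendixC.HermSpace F E` with `V.n = 2` and `V.IsSignatureN1At (restr F E τ₁')` (for `n = 2`,
  `(n−1,1) = (1,1)` and `(n,0) = (2,0)` — this IS the hypothesis of Rem. C.2); «`G(𝔸^∞)`» = `V.Gfin` (REAL: `U(V)(𝔸_F^∞)` as a
  closed subgroup of `GL₂(𝔸_{E,f})`); «the Shimura varieties `{Sh(G,h)_K}` defined over `E`» for `h = h_{V,τ'₁}` = a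
  `V.ShimuraSystem τ₁'` (Rem. C.2's ⟨CARRIER⟩ structure of `AppendixC.DefC1toC3`).  ⟨CARRIER⟩ «their Baily–Borel
  compactification `S̄h(G,h)_K`, … smooth curves over `E`» (l. 5355; «smooth projective curve», l. 5525): `ShBar K : SchemeOver E`
  with an open immersion `Sh_K ↪ S̄h_K`, transition maps, and the printed attribute `IsSmoothProjective 1` as a `Prop` field
  (the precedent: `ShimuraSystem.quasiProjective`/`smooth_dim`).  «the Albanese variety (Jacobian) `A_K` of `S̄h(G,h)_K`»
  (l. 5463, 5626) = the tree's `Motives.Jacobian (ShBar K)` (Milne JV Prop. 6.4), a field `jac K`.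
* ⟨CARRIER⟩ `H1B`, `ρB`: the `ℂ[G(𝔸^∞)]`-module «`H¹_B(S̄h(G,h), ℂ) := lim_K H¹_B(S̄h(G,h)_K, ℂ)`» (a `Representation ℂ V.Gfin H1B`).
  The Matsushima isomorphism (display before Def. D.3) and Zucker's conjecture (§D.2) that produce it are NOT typed (no
  `(𝔤,K)`-cohomology of automorphic spectra of `U(V)` in the tree at this generality); what Def. D.3 – Prop. D.4 USE of it —
  Hom spaces `Hom_{ℂ[G(𝔸^∞)]}(π^∞, H¹_B)` and their dimension — is REAL: Mathlib `Representation.IntertwiningMap` and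
  `Module.finrank ℂ`.
* ⟨CARRIER⟩ THE CLASSES `Irr`: «isomorphism classes of irreducible admissible representations of `G(𝔸^∞)`» — an index type
  `Irr` with a representative `π i : Representation ℂ V.Gfin (W i)` of every class (READING I1–I2 of `Def411AsPrinted`:
  «irreducible» = Mathlib `Representation.IsIrreducible` (non-zero), «admissible representation of `G(𝔸^∞)`» = `IsSmoothRep ∧
  IsAdmissibleRep`, imported); the standing sentence «isomorphism classes» is the predicate `SecD3Data.IrrAsPrinted`
  (representatives irreducible admissible, pairwise non-isomorphic, exhaustive), hypothesised by consumers, not asserted.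
* ⟨CARRIER⟩ THE CUSPIDAL MULTIPLICITIES `mCusp10 i = m_cusp(π_∞^{(1,0)} ⊗ π^∞)`, `mCusp01 i = m_cusp(π_∞^{(0,1)} ⊗ π^∞)` (l. 5368;
  `m_cusp` = multiplicity in `L²_cusp(G(ℚ)\G(𝔸))`, Def. B.1 l. 4229; `π_∞^{(1,0)}`, `π_∞^{(0,1)}` the two representations of
  `G(ℝ) = U(1,1) × U(2)^{d−1}` of l. 5361–5362, Lemma D.2 (3) = `LemD2.LemD2_3AsPrinted`).  Functions `Irr → ℕ`: the honest
  `L²` carriers of the tree (`Rogawski1990/CurveCohomologicalSpectrum`: `DiscreteAutomorphicRep`, `multiplicity`,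
  `IsHolCotangentAt₂`) realise them for a matrix presentation of `U(V)`; docking is the consumer's (TODO(dock-mcusp)).
* ⟨CARRIER⟩ THE ADÈLIC OSCILLATOR TRIPLES (Def. 4.11, l. 2083–2097 = `Def411AsPrinted`): a type `Triple` of triples
  `t = (μ, ε, χ)` with REAL first entry `tμ t : IdeleClassGroup E →ₜ* Circle` («conjugate symplectic automorphic character»,
  `IdeleClassGroup.IsConjugateSymplectic`, Def. 4.1 = tree `ConjugateSelfDualCharacters`), ⟨CARRIER⟩ `tε t : Eps` with
  `epsOf : E → Eps` («`e ↦ (e Nm_{E_v/F_v} E_v^×)_v`», exactly `Thm418Data.epsOf`), ⟨CARRIER⟩ `tχ t : Chi` with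
  `chiCheck : Chi → HeckeCharacter E` («`χ̌(x) = χ(x/x^c)`», §D.1 l. 5224; REAL for the `(F,E,c)`-presentation as
  `HeckeCharacter.checkOfChi`, file `CheckOfChi` — TODO(dock-chi)), and the representation `ω t` of `G(𝔸^∞)` on `ωW t` =
  «`ω(μ, ε, χ)`».  «`μ` of weight one» = `IdeleClassGroup.HasWeight E μ 1`, «`τ'₁ ∈ Φ_μ`» = `∃ Φ, HasCMType E μ Φ ∧ τ₁' ∈ Φ`
  (Def. 4.3 = tree `ConjugateSelfDualCharacters`; `Φ_μ` is unique, `HasCMType.unique`).  «`μ · | |_E^{−1/2}`» =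
  `IdeleClassGroup.muAlg E μ` (tree `IdeleClassCharacterAlgebraicTwist`, [Liu2021, §4.1 l. 1922]); «`μ^c`» =
  `HeckeCharacter.galConj (AppendixC.conj F E) (toHeckeCharacter E μ)`; «`| |_E^{−1/2}`» = `(normSqrtCharacter E)⁻¹`.
* ⟨CARRIER⟩ THE `ℓ`-ADIC DATA, for a prime `ℓ` and `ι : ℂ ≃+* ℚ_ℓ^{ac}` (`ℚ_ℓ^{ac}` = Mathlib `PadicAlgCl ℓ`): structure
  `SecD3Data.EllAdic D ℓ` — `H1et` = «`H¹_ét(S̄h(G,h), ℚ_ℓ^{ac})`» with COMMUTING actions `ρet` of `G(𝔸^∞)` and `γet` of `Γ_E`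
  (REAL commutation field); `πι ι i` = «`ι_ℓ ∘ π^∞`»; `R ι i` = «`H¹_{ι_ℓ}(π^∞) = ρ_{ι_ℓ}(π^∞)`» with its `Γ_E`-action `γR`, PINNED
  (REAL fields) to the intertwiner space `IntertwiningMap (πι ι i) ρet` with `Γ_E` acting by post-composition; `rhoEll i` =
  «`ρ_ℓ(π^∞) : E^×\𝔸_E^× → ℂ^×`» as a `HeckeCharacter E` together with `lAdicOf ι ψ : Γ_E →* (ℚ_ℓ^{ac})ˣ` («the `ℓ`-adic
  character inducing `ψ` via `ι_ℓ`»), PINNED (`lAdicOf_spec`) for algebraic `ψ` to the tree's `ℓ`-adic avatar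
  `HasInfinityType.lAdicAvatar` ([Serre1968, II §2.7], `WeilLAdicCharacterLocalShape`) through the idelic Artin map
  `NumberFields.ideleArtinMap` with the Frobenius normalisation of [Liu2021, §1.7 l. 1135] (uniformizer ↦ GEOMETRIC Frobenius)
  spelled out, and the REAL pin «for endoscopic cohomological `π^∞`, `Γ_E` acts on `ρ_{ι_ℓ}(π^∞)` by the scalar character
  `lAdicOf ι (rhoEll i)`».
  `cTilde`/`conjGal` (a lift of `c` to `Ē` and the induced automorphism `σ ↦ c̃σc̃⁻¹` of `Γ_E`, REAL pin) serve «`ρ^c`».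
* Def. D.3 (`Liu2021_D3_*`, REAL definitions on the datum), Prop. D.4 (1)/(2), Rem. D.5, Thm. D.6 (1), (2a), (2b), the
  (D.3)-decomposition + the three `A(π̲^∞)` bullets (structure `AlbaneseD3Data`, predicate `Liu2021_D3display_AsPrinted`) and
  Cor. D.7 follow, each with its docstring quoting the clause it types and the READINGS it makes; the §D.4 standing data
  (`SecD4Data`), Prop. D.8, Cor. D.9 and the §D.4 l. 5626–5627 paragraph are the sibling file `SecD4ProofOfThmD6`.

NOT TYPED (recorded verbatim above; no carrier is posited for them): the Matsushima/Zucker isomorphism of §D.2–§D.3; Thm. D.6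
(2c) (local–global compatibility with the local Langlands correspondence `𝓛_{2,E_w}` and the Weil–Deligne functor — neither is
in the tree for `GL₂(E_w)`; `Liu2021_D6_2` types (2a) ∧ (2b) and says so); in Cor. D.7 the clause «compatible with changing
`K` in the obvious way» and the characterisation «… if and only if … same standard base change to `GL₂(𝔸_E^∞)`» (standard
base change not in the tree; typed as the posited relation `SameBaseChange` with the biconditional REAL around it); the
`Hecke-module` qualifier of the two displayed isomorphisms under (D.3) (typed as `ℂ`-linear identifications of the posited
Betti spaces, the `𝒞^∞_c(K\G/K, ℚ)`-equivariance recorded here); all proofs.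

## References
* [Liu2021] Y. Liu, Camb. J. Math. 9 (2021) 1–147 = arXiv:2102.11518: App. D §D.3 (l. 5350–5494; pp. 129–134), §D.4
  (l. 5497–5633; pp. 134–140); App. C §C.1 Rem. C.2 (l. 4602–4609; p. 108); Def. 4.1/4.3 (pp. 41–42), Def. 4.11 (p. 46),
  §4.1 l. 1922 (`μ| |^{−1/2}`), Lemma 2.4 (p. 23), Cor. 4.20 (p. 54), Def. B.1 (p. 96), Thm. B.4 (p. 98), Lem. D.1/D.2 (pp. 125–127).
* [Har93] M. Harris, J. AMS 6 (1993); [Rog90] J. Rogawski, Ann. Math. Stud. 123, §11; [Car86] H. Carayol, Compositio 59 (1986);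
  [LL99] Q. Liu, D. Lorenzini, Compositio 118 (1999) Prop. 4.4 (a); [BR93] Blasius–Rogawski, Invent. 114 §4; [Car12] A. Caraiani,
  Duke 161 Thm. 1.1; [Raj00] C. S. Rajan, PAMS 128 Thm. 1; [YZZ13] Yuan–Zhang–Zhang, Ann. Math. Stud. 184 §3.2.1 — the inputs
  Liu prints for the proofs (not read for this file; locators in `shelf/Liu2021-AppD3-D4-Thm415-ProofInputs.md`).
* [Milne1986JacobianVarieties] J. Milne, *Jacobian varieties*, Prop. 6.4 (the tree's `Motives.Jacobian`);
  [SerreAbelianLadic1968] J.-P. Serre, *Abelian ℓ-adic representations* (1968), Ch. II §2.7 (the tree's `lAdicAvatar`);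
  [Shimura1998] §18.3 (the tree's `ideleArtinMap`); [Milne1999] J. Milne, *Lefschetz motives and the Tate conjecture* (1999) §2
  p. 54 and [Deligne1982HodgeCycles] §5 (CM type, the tree's `Milne1999.IsOfCMType`).
-/

noncomputable section

open NumberField CategoryTheory AlgebraicGeometry
open Literature.AlgebraicGeometry.Motives (CMType SchemeOver AbelianVariety Jacobian IsSmoothProjective)
open Literature.NumberTheory.GaloisRepresentations (HeckeCharacter)
open Literature.NumberTheory.Automorphic.IdeleClassGroup (toHeckeCharacter muAlg)

namespace Literature.NumberTheory.Automorphic.Liu2021.AppendixD.SecD3CohomologyUnitaryCurves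

variable (F E : Type) [Field F] [NumberField F] [IsTotallyReal F] [Field E] [NumberField E] [Algebra F E]
  [IsTotallyComplex E] [Algebra.IsQuadraticExtension F E]

/-! ## §D.3 standing data (l. 5353–5363; p. 129 L39 – p. 130 L26): the datum -/

/-- ⟨CARRIER⟩ **The standing data of [Liu2021, App. D §D.3]** (l. 5353–5363, p. 129 L39 – p. 130 L26) together with the
objects that Def. D.3 – Cor. D.7 speak about: the fixed embedding `τ'₁`, the hermitian PLANE `V` of signature `(1,1)` at
`τ₁` and `(2,0)` elsewhere (REAL: `AppendixC.HermSpace`), Remark C.2's Shimura curves `Sh(G,h)_K` over `E` (the tree's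
`HermSpace.ShimuraSystem`), their compactifications `S̄h(G,h)_K` with Jacobians `A_K`, the `G(𝔸^∞)`-module
`H¹_B(S̄h(G,h), ℂ)`, the classes of irreducible admissible representations `π^∞` of `G(𝔸^∞)` with their two cuspidal
multiplicities, the `Gal(ℂ/ℚ)`-action «through the coefficients» (l. 5463), and the adèlic oscillator triples `(μ, ε, χ)` of
Def. 4.11 with their representations `ω(μ, ε, χ)`.  Every `Prop` field is a REAL printed attribute; nothing printed as a
RESULT is a field.  A consumer supplies the datum; nothing is asserted.
[cite: Liu2021, App. D §D.3 (l. 5353–5363; p. 129 L39 – p. 130 L26)] -/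
structure SecD3Data : Type 1 where
  /-- «a fixed complex embedding `τ'₁ : E ↪ ℂ`» (l. 5353). REAL. -/
  τ₁' : E →+* ℂ
  /-- «Let `V` be a hermitian space over `E` of rank `2` …» (l. 5355): REAL, `AppendixC.HermSpace` (App. C l. 4558). -/
  V : AppendixC.HermSpace F E
  /-- «… of rank `2`» (l. 5355). -/
  rank_eq_two : V.n = 2
  /-- «the Shimura varieties `{Sh(G,h)_K}` defined over `E`», `h := h_{V,τ'₁}` (l. 5355) — Remark C.2's system
  (`AppendixC.HermSpace.ShimuraSystem`, whose REAL field `sig_eq : V.IsSignatureN1At (restr F E τ₁')` is, for `n = 2`, exactly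
  «signature `(1,1)` at `τ₁` and `(2,0)` elsewhere», l. 5355). -/
  S : V.ShimuraSystem τ₁'
  /-- ⟨CARRIER⟩ «their Baily–Borel compactification `S̄h(G,h)_K`» (l. 5355), a scheme over `E`, for every level `K`
  (meaningful for the neat open compact `K` of `S`). -/
  ShBar : Subgroup V.Gfin → SchemeOver E
  /-- ⟨CARRIER⟩ the open immersion `Sh(G,h)_K ↪ S̄h(G,h)_K` of the compactification (l. 5355). -/
  openImm : ∀ K : Subgroup V.Gfin, S.Sh K ⟶ ShBar K
  /-- the compactification map is an open immersion (l. 5355), for neat open compact `K`. -/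
  isOpenImmersion_openImm : ∀ K, S.IsNeat K → IsOpen (K : Set V.Gfin) → IsCompact (K : Set V.Gfin) →
    IsOpenImmersion (openImm K).left
  /-- «all of which are smooth curves over `E`» (l. 5355), «the smooth projective curve `S̄h(G,h)_K`» (l. 5525): for neat open
  compact `K`, `S̄h(G,h)_K` is smooth projective of dimension `1` over `E` (tree `Motives.IsSmoothProjective`). -/
  shBar_smoothProjective : ∀ K, S.IsNeat K → IsOpen (K : Set V.Gfin) → IsCompact (K : Set V.Gfin) →
    IsSmoothProjective 1 (ShBar K)
  /-- ⟨CARRIER⟩ the transition maps `S̄h(G,h)_{K'} → S̄h(G,h)_K`, `K' ≤ K`, of the compactified system (l. 5359: `lim_K`). -/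
  trBar : ∀ {K K' : Subgroup V.Gfin}, K' ≤ K → (ShBar K' ⟶ ShBar K)
  /-- the transition maps extend those of `{Sh(G,h)_K}` (l. 5355, 5359). -/
  openImm_trBar : ∀ {K K' : Subgroup V.Gfin} (h : K' ≤ K), openImm K' ≫ trBar h = S.tr h ≫ openImm K
  /-- «the Albanese variety (Jacobian) `A_K` of `S̄h(G,h)_K`» (l. 5463; l. 5626 «Let `A_K` be the Jacobian of `S̄h(G,h)_K`»):
  the tree's `Motives.Jacobian` ([Milne1986JacobianVarieties, Prop. 6.4]), for the neat open compact levels `K` only (the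
  curves exist for those; `IsOpenCompact` of `Thm418AsPrinted`); `(jac K hn hK).J : AbelianVariety E`. -/
  jac : ∀ K : Subgroup V.Gfin, S.IsNeat K → IsOpenCompact K → Jacobian (ShBar K)
  /-- ⟨CARRIER⟩ the `ℂ`-vector space «`H¹_B(S̄h(G,h), ℂ) := lim_K H¹_B(S̄h(G,h)_K, ℂ)`» (l. 5359). -/
  H1B : ModuleCat.{0} ℂ
  /-- ⟨CARRIER⟩ the `G(𝔸^∞)`-module structure of `H¹_B(S̄h(G,h), ℂ)` (l. 5357–5359: «of `G(𝔸^∞)`-modules»). -/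
  ρB : Representation ℂ V.Gfin H1B
  /-- ⟨CARRIER⟩ the set of «isomorphism classes of … irreducible admissible representations of `G(𝔸^∞)`» (l. 5366, 5372). -/
  Irr : Type
  /-- ⟨CARRIER⟩ the space of a representative `π^∞` of the class `i`. -/
  W : Irr → ModuleCat.{0} ℂ
  /-- ⟨CARRIER⟩ the representative `π^∞` of the class `i`, a representation of `G(𝔸^∞)` (l. 5366). -/
  π : ∀ i, Representation ℂ V.Gfin (W i)
  /-- ⟨CARRIER⟩ `m_cusp(π_∞^{(1,0)} ⊗ π^∞)`, the cuspidal multiplicity (l. 5368; Def. B.1 l. 4229), a function of the class. -/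
  mCusp10 : Irr → ℕ
  /-- ⟨CARRIER⟩ `m_cusp(π_∞^{(0,1)} ⊗ π^∞)` (l. 5368). -/
  mCusp01 : Irr → ℕ
  /-- ⟨CARRIER⟩ «`Gal(ℂ/ℚ)` acts on `𝒞_V` through the coefficients» (l. 5463): `σ · [π^∞] := [σ ∘ π^∞]` on classes,
  `Gal(ℂ/ℚ)` = `ℂ ≃ₐ[ℚ] ℂ`. -/
  galAct : (ℂ ≃ₐ[ℚ] ℂ) → Irr → Irr
  /-- the action is an action: `1 · i = i` (l. 5463). -/
  galAct_one : ∀ i, galAct 1 i = i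
  /-- the action is an action: `(στ) · i = σ · (τ · i)` (l. 5463). -/
  galAct_mul : ∀ σ τ i, galAct (σ * τ) i = galAct σ (galAct τ i)
  /-- ⟨CARRIER⟩ the collections `ε = (ε_v)_v`, `ε_v ∈ E_v^{−×}/Nm_{E_v/F_v} E_v^×`, of Def. 4.11 (l. 2088) — as `Thm418Data.Eps`. -/
  Eps : Type
  /-- ⟨CARRIER⟩ `e ↦ (e Nm_{E_v/F_v} E_v^×)_v` (Rem. D.5 first bullet, l. 5399; Def. 4.12 l. 2105) — as `Thm418Data.epsOf`. -/
  epsOf : E → Eps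
  /-- ⟨CARRIER⟩ the automorphic characters `χ : E¹\(𝔸_E^∞)¹ → ℂ^×` of Def. 4.11 (l. 2090) — as `Thm418Data.Chi`. -/
  Chi : Type
  /-- ⟨CARRIER⟩ `χ ↦ χ̌`, «`χ̌(x) = χ(x/x^c)`» (§D.1 l. 5224), an automorphic character of `E^×\𝔸_E^×`, here a Hecke character
  (REAL as `HeckeCharacter.checkOfChi` in the `(F,E,c)`-presentation of `CheckOfChi`; TODO(dock-chi)). -/
  chiCheck : Chi → HeckeCharacter E
  /-- ⟨CARRIER⟩ the adèlic oscillator triples `(μ, ε, χ)` (Def. 4.11, l. 2083–2091). -/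
  Triple : Type
  /-- the first entry `μ` of a triple — REAL: a continuous unitary idele class character of `E` (Def. 4.11 first bullet). -/
  tμ : Triple → (IdeleClassGroup E →ₜ* Circle)
  /-- «conjugate symplectic» (Def. 4.11 first bullet; Def. 4.1) — REAL, tree `IdeleClassGroup.IsConjugateSymplectic`. -/
  isConjugateSymplectic_tμ : ∀ t, letI : IsCMField E := isCMField F E; IdeleClassGroup.IsConjugateSymplectic E (tμ t)
  /-- the second entry `ε` of a triple. -/
  tε : Triple → Eps
  /-- the third entry `χ` of a triple. -/
  tχ : Triple → Chi
  /-- triples are determined by their entries (they ARE triples). -/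
  triple_ext : ∀ t t', tμ t = tμ t' → tε t = tε t' → tχ t = tχ t' → t = t'
  /-- ⟨CARRIER⟩ the space of «the adèlic oscillator representation `ω(μ, ε, χ)`» (Def. 4.11, l. 2092–2096). -/
  ωW : Triple → ModuleCat.{0} ℂ
  /-- ⟨CARRIER⟩ the action of `G(𝔸^∞)` on `ω(μ, ε, χ)` (Def. 4.11). -/
  ω : ∀ t, Representation ℂ V.Gfin (ωW t)

namespace SecD3Data

variable {F E}
variable (D : SecD3Data F E)

/-- The standing sentence «isomorphism classes of … irreducible admissible representations of `G(𝔸^∞)`» (l. 5366, 5372) as a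
predicate on the carrier `Irr`: every representative is irreducible (Mathlib `Representation.IsIrreducible`), smooth and
admissible (`IsSmoothRep`, `IsAdmissibleRep` of `Def411AsPrinted`, READING I2), two classes with isomorphic representatives are
equal, and every irreducible admissible representation of `G(𝔸^∞)` (on a `Type`-small space) is isomorphic to a representative.
Hypothesised by consumers; not asserted. [cite: Liu2021, Def. D.3 (l. 5366–5372; p. 130)] -/
def IrrAsPrinted (D : SecD3Data F E) : Prop :=
  (∀ i, (D.π i).IsIrreducible ∧ IsSmoothRep (D.π i) ∧ IsAdmissibleRep (D.π i)) ∧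
  (∀ i j, Nonempty (Representation.Equiv (D.π i) (D.π j)) → i = j) ∧
  (∀ (W' : Type) [AddCommGroup W'] [Module ℂ W'] (ρ : Representation ℂ D.V.Gfin W'),
    ρ.IsIrreducible → IsSmoothRep ρ → IsAdmissibleRep ρ → ∃ i, Nonempty (Representation.Equiv ρ (D.π i)))

/-- «`Gal(ℂ/ℚ)` acts … through the coefficients» (l. 5463): the class `σ · i` is represented by a `σ`-SEMILINEAR transport of
`π_i` — there is an additive bijection `W i ≃+ W (σ · i)`, `σ`-semilinear, intertwining the two actions.  Hypothesised by
consumers; not asserted. [cite: Liu2021, App. D p. 133 (l. 5463)] -/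
def GalActAsPrinted (D : SecD3Data F E) : Prop :=
  ∀ (σ : ℂ ≃ₐ[ℚ] ℂ) (i : D.Irr), ∃ f : D.W i ≃+ D.W (D.galAct σ i),
    (∀ (z : ℂ) (w : D.W i), f (z • w) = σ z • f w) ∧ ∀ (g : D.V.Gfin) (w : D.W i), f (D.π i g w) = D.π (D.galAct σ i) g (f w)

/-! ## Definition D.3 (l. 5365–5373; p. 130 L27–46) — REAL definitions on the datum -/

/-- **[Liu2021, Def. D.3, first bullet]**: the class `i = [π^∞]` is *stable cohomological* — «both `π_∞^{(1,0)} ⊗ π^∞` and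
`π_∞^{(0,1)} ⊗ π^∞` have positive cuspidal multiplicity». [cite: Liu2021, Def. D.3 (p. 130)] -/
def Liu2021_D3_isStableCohomological (i : D.Irr) : Prop :=
  0 < D.mCusp10 i ∧ 0 < D.mCusp01 i

/-- **[Liu2021, Def. D.3, second bullet]**: `i = [π^∞]` is *endoscopic cohomological* — «exactly one of `π_∞^{(1,0)} ⊗ π^∞` and
`π_∞^{(0,1)} ⊗ π^∞` has positive cuspidal multiplicity». [cite: Liu2021, Def. D.3 (p. 130)] -/
def Liu2021_D3_isEndoscopicCohomological (i : D.Irr) : Prop :=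
  (0 < D.mCusp10 i ∧ D.mCusp01 i = 0) ∨ (D.mCusp10 i = 0 ∧ 0 < D.mCusp01 i)

/-- **[Liu2021, Def. D.3]: `𝒞_V^{st}`**, «the set of isomorphism classes of stable cohomological irreducible admissible
representations of `G(𝔸^∞)`». [cite: Liu2021, Def. D.3 (p. 130)] -/
def Liu2021_D3_CVst : Set D.Irr := {i | D.Liu2021_D3_isStableCohomological i}

/-- **[Liu2021, Def. D.3]: `𝒞_V^{end}`**, «the set of isomorphism classes of endoscopic cohomological irreducible admissible
representations of `G(𝔸^∞)`». [cite: Liu2021, Def. D.3 (p. 130)] -/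
def Liu2021_D3_CVend : Set D.Irr := {i | D.Liu2021_D3_isEndoscopicCohomological i}

/-- **[Liu2021, Def. D.3]: `𝒞_V := 𝒞_V^{st} ∐ 𝒞_V^{end}`** (the two sets are disjoint by definition; the disjoint union is their
union in `Irr`). [cite: Liu2021, Def. D.3 (p. 130)] -/
def Liu2021_D3_CV : Set D.Irr := D.Liu2021_D3_CVst ∪ D.Liu2021_D3_CVend

/-! ## Proposition D.4 (l. 5376–5383; p. 130 L47–54) -/

/-- The printed qualifier of Prop. D.4 (1) / Thm. D.6 (1) on a triple `t = (μ, ε, χ)`: «with `μ` of weight one and satisfying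
`τ'₁ ∈ Φ_μ`» (Def. 4.3: tree `IdeleClassGroup.HasWeight E μ 1`, `HasCMType E μ Φ`; `Φ_μ` is unique, `HasCMType.unique`).
[cite: Liu2021, Prop. D.4 (1) (p. 130); Def. 4.3 (p. 41)] -/
def IsWeightOneAtTau1 (t : D.Triple) : Prop :=
  letI : IsCMField E := isCMField F E
  IdeleClassGroup.HasWeight E (D.tμ t) 1 ∧ ∃ Φ : CMType E, IdeleClassGroup.HasCMType E (D.tμ t) Φ ∧ D.τ₁' ∈ Φ.1

/-- «`π^∞` is isomorphic to `ω(μ, ε, χ)`» (l. 5379): an isomorphism of representations of `G(𝔸^∞)` (Mathlib `Representation.Equiv`).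
[cite: Liu2021, Prop. D.4 (1) (p. 130)] -/
def IsOmega (i : D.Irr) (t : D.Triple) : Prop :=
  Nonempty (Representation.Equiv (D.π i) (D.ω t))

/-- «`Hom_{ℂ[G(𝔸^∞)]}(π^∞, H¹_B(S̄h(G,h), ℂ))`» (l. 5379, 5381): the `ℂ`-space of `G(𝔸^∞)`-intertwiners (Mathlib
`Representation.IntertwiningMap`). [cite: Liu2021, Prop. D.4 (p. 130)] -/
abbrev homH1B (i : D.Irr) : Type := Representation.IntertwiningMap (D.π i) D.ρB

/-- **[Liu2021, Proposition D.4 (1)] EXACTLY AS PRINTED**: «If `π^∞` is endoscopic cohomological, then there exists a unique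
adèlic oscillator triple `(μ, ε, χ)` (Definition 4.11) with `μ` of weight one and satisfying `τ'₁ ∈ Φ_μ`, such that `π^∞` is
isomorphic to `ω(μ, ε, χ)`. Moreover, `Hom_{ℂ[G(𝔸^∞)]}(π^∞, H¹_B(S̄h(G,h), ℂ))` has dimension `1`.»  For every class `i`.
NO PROOF ([Har93], [Rog90 §11], Arthur's multiplicity formula, Thm. B.4, Lemma D.1 (4) — l. 5385–5393).
[cite: Liu2021, Prop. D.4 (1) (p. 130)] -/
def Liu2021_D4_1 (D : SecD3Data F E) : Prop :=
  ∀ i : D.Irr, D.Liu2021_D3_isEndoscopicCohomological i →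
    (∃! t : D.Triple, D.IsWeightOneAtTau1 t ∧ D.IsOmega i t) ∧ Module.finrank ℂ (D.homH1B i) = 1

/-- **[Liu2021, Proposition D.4 (2)] EXACTLY AS PRINTED**: «If `π^∞` is stable cohomological, then
`Hom_{ℂ[G(𝔸^∞)]}(π^∞, H¹_B(S̄h(G,h), ℂ))` has dimension `2`.»  NO PROOF. [cite: Liu2021, Prop. D.4 (2) (p. 130)] -/
def Liu2021_D4_2 (D : SecD3Data F E) : Prop :=
  ∀ i : D.Irr, D.Liu2021_D3_isStableCohomological i → Module.finrank ℂ (D.homH1B i) = 2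

/-! ## Remark D.5 (l. 5396–5405; p. 131 L35–42) -/

/-- The three bulleted conditions of Rem. D.5 on an element `e ∈ E^{×−}` for the triple `t = (μ, ε, χ)` and the CM type `Φ` of
`μ`, with the sign at `τ'₁` as a parameter (`neg = true`: «negative», the `(1,0)` case; `neg = false`: «positive», the `(0,1)`
case): «`e ∈ E^{×−}`» (`e ≠ 0`, `c e = −e`); • «`ε_v = e Nm_{E_v/F_v} E_v^×` for every nonarchimedean place `v` of `F`» =
`tε t = epsOf e` (READING: the collection GENERATED by `e`, `Thm418Data.epsOf`); • «`τ'_i(e)` has negative imaginary part for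
`i = 2, …, d`, where `τ'_i` is the unique element in `Φ_μ` above `τ_i`» = for every real embedding `τ ≠ τ₁` of `F`,
`Im ((CMType.above Φ τ) e) < 0` (`AppendixC.CMType.above` IS «the unique element in `Φ` above `τ`», App. C l. 4563);
• «`τ'₁(e)` has negative (resp. positive) imaginary part».  (For `neg = true` and `τ'₁ ∈ Φ` this is the tree's
`Liu2021.IsAdmissibleElement E Φ e` of Def. 4.12.) [cite: Liu2021, Rem. D.5 (p. 131)] -/
def RemD5Conditions (t : D.Triple) (Φ : CMType E) (neg : Bool) (e : E) : Prop :=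
  e ≠ 0 ∧ AppendixC.conj F E e = -e ∧
  D.tε t = D.epsOf e ∧
  (∀ τ : F →+* ℝ, τ ≠ AppendixC.restr F E D.τ₁' → ((AppendixC.CMType.above F E Φ τ) e).im < 0) ∧
  (if neg then (D.τ₁' e).im < 0 else 0 < (D.τ₁' e).im)

/-- **[Liu2021, Remark D.5] EXACTLY AS PRINTED**: «for `π^∞ ≃ ω(μ, ε, χ)` that is endoscopic cohomological, we have
`m_cusp(π_∞^{(1,0)} ⊗ π^∞) = 1` (resp. `m_cusp(π_∞^{(0,1)} ⊗ π^∞) = 1`) if and only if there exists some `e ∈ E^{×−}` such that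
[the three bullets of `RemD5Conditions`, with «negative» (resp. «positive») at `τ'₁`]».  READING: `(μ, ε, χ)` is the triple of
Prop. D.4 (1) («The proof of Proposition D.4(1) implies …»): `μ` of weight one with `τ'₁ ∈ Φ_μ`, `Φ_μ` its CM type.  Printed as
a Remark (a consequence of the proof of D.4 (1)); NO PROOF. [cite: Liu2021, Rem. D.5 (p. 131)] -/
def Liu2021_D5 (D : SecD3Data F E) : Prop :=
  letI : IsCMField E := isCMField F E
  ∀ (i : D.Irr) (t : D.Triple) (Φ : CMType E),
    D.Liu2021_D3_isEndoscopicCohomological i → D.IsOmega i t → D.IsWeightOneAtTau1 t →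
    IdeleClassGroup.HasCMType E (D.tμ t) Φ →
      (D.mCusp10 i = 1 ↔ ∃ e : E, D.RemD5Conditions t Φ true e) ∧
      (D.mCusp01 i = 1 ↔ ∃ e : E, D.RemD5Conditions t Φ false e)

/-! ## The `ℓ`-adic set-up (l. 5408–5426; pp. 131–132) -/

/-- ⟨CARRIER⟩ **The `ℓ`-adic data of [Liu2021, App. D pp. 131–132]** for the datum `D` and a rational prime `ℓ`
(`ℚ_ℓ^{ac}` = `PadicAlgCl ℓ`; `Γ_E = Field.absoluteGaloisGroup E`, READING G1): `H¹_ét(S̄h(G,h), ℚ_ℓ^{ac}) := lim_K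
H¹_ét(S̄h(G,h)_K ⊗_E ℂ, ℚ_ℓ^{ac})` with its commuting `G(𝔸^∞)`- and Galois actions; for every `ι_ℓ : ℂ ≃ ℚ_ℓ^{ac}` and class `i`
the representation «`ι_ℓ ∘ π^∞`» and the Galois representation «`H¹_{ι_ℓ}(π^∞) =: ρ_{ι_ℓ}(π^∞)`» PINNED to the intertwiner space
`Hom_{ℚ_ℓ^{ac}[G(𝔸^∞)]}(ι_ℓ ∘ π^∞, H¹_ét)` with `Γ_E` acting by post-composition (REAL fields `RIso`, `RIso_γ`); the automorphic
characters «`ρ_ℓ(π^∞)`»; the dictionary `lAdicOf ι` «automorphic character ↦ the `ℓ`-adic character inducing it via `ι_ℓ`»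
([Serre1968, III §2.3]) with the REAL pin `γR_eq_lAdicOf`; and a lift `c̃` of `c` to `Ē` with the induced automorphism
`conjGal` of `Γ_E` (for «`ρ^c`», Thm. D.6 (2b)).  Nothing is asserted.
[cite: Liu2021, App. D pp. 131–132 (l. 5408–5426)] -/
structure EllAdic (ℓ : ℕ) [Fact ℓ.Prime] : Type 1 where
  /-- ⟨CARRIER⟩ «`H¹_ét(S̄h(G,h), ℚ_ℓ^{ac}) := lim_K H¹_ét(S̄h(G,h)_K ⊗_E ℂ, ℚ_ℓ^{ac})`» (l. 5410–5411). -/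
  H1et : ModuleCat.{0} (PadicAlgCl ℓ)
  /-- ⟨CARRIER⟩ its `G(𝔸^∞)`-module structure (l. 5417: «of `G(𝔸^∞)`-modules»). -/
  ρet : Representation (PadicAlgCl ℓ) D.V.Gfin H1et
  /-- ⟨CARRIER⟩ its Galois action (l. 5423; READING G1: `Γ_E = Gal(Ē/E)`). -/
  γet : Representation (PadicAlgCl ℓ) (Field.absoluteGaloisGroup E) H1et
  /-- the two actions commute (the Galois action is `G(𝔸^∞)`-linear: `H¹_{ι_ℓ}(π^∞)` «is a representation of `Gal(ℂ/E)`», l. 5423). -/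
  ρet_comm : ∀ (g : D.V.Gfin) (σ : Field.absoluteGaloisGroup E), (ρet g) ∘ₗ (γet σ) = (γet σ) ∘ₗ (ρet g)
  /-- ⟨CARRIER⟩ the space of «`ι_ℓ ∘ π^∞`» (l. 5421) for `ι_ℓ : ℂ ≃ ℚ_ℓ^{ac}` and a class `i`. -/
  Wι : (ℂ ≃+* PadicAlgCl ℓ) → D.Irr → ModuleCat.{0} (PadicAlgCl ℓ)
  /-- ⟨CARRIER⟩ «`ι_ℓ ∘ π^∞`», the representation of `G(𝔸^∞)` over `ℚ_ℓ^{ac}` deduced from `π^∞` by the field isomorphism `ι_ℓ`. -/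
  πι : ∀ (ι : ℂ ≃+* PadicAlgCl ℓ) (i : D.Irr), Representation (PadicAlgCl ℓ) D.V.Gfin (Wι ι i)
  /-- «`ι_ℓ ∘ π^∞`» IS `π^∞` transported along `ι_ℓ`: a `ι_ℓ`-semilinear additive bijection `W i ≃+ Wι ι i` intertwining the
  actions (REAL pin of the carrier). -/
  πι_transport : ∀ (ι : ℂ ≃+* PadicAlgCl ℓ) (i : D.Irr), ∃ f : D.W i ≃+ Wι ι i,
    (∀ (z : ℂ) (w : D.W i), f (z • w) = ι z • f w) ∧ ∀ (g : D.V.Gfin) (w : D.W i), f (D.π i g w) = πι ι i g (f w)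
  /-- ⟨CARRIER⟩ the `ℚ_ℓ^{ac}`-vector space «`H¹_{ι_ℓ}(π^∞)`» carrying «`ρ_{ι_ℓ}(π^∞)`» (l. 5419–5423). -/
  R : (ℂ ≃+* PadicAlgCl ℓ) → D.Irr → ModuleCat.{0} (PadicAlgCl ℓ)
  /-- ⟨CARRIER⟩ «`ρ_{ι_ℓ}(π^∞)`», the representation of `Γ_E` on `H¹_{ι_ℓ}(π^∞)` (l. 5423). -/
  γR : ∀ (ι : ℂ ≃+* PadicAlgCl ℓ) (i : D.Irr), Representation (PadicAlgCl ℓ) (Field.absoluteGaloisGroup E) (R ι i)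
  /-- REAL pin: «`H¹_{ι_ℓ}(π^∞) := Hom_{ℚ_ℓ^{ac}[G(𝔸^∞)]}(ι_ℓ ∘ π^∞, H¹_ét(S̄h(G,h), ℚ_ℓ^{ac}))`» (l. 5420–5421) — a `ℚ_ℓ^{ac}`-linear
  identification of the carrier with Mathlib's intertwiner space. -/
  RIso : ∀ (ι : ℂ ≃+* PadicAlgCl ℓ) (i : D.Irr), R ι i ≃ₗ[PadicAlgCl ℓ] Representation.IntertwiningMap (πι ι i) ρet
  /-- REAL pin: `Γ_E` acts on `H¹_{ι_ℓ}(π^∞)` by post-composition with its action on `H¹_ét` (l. 5423). -/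
  RIso_γ : ∀ (ι : ℂ ≃+* PadicAlgCl ℓ) (i : D.Irr) (σ : Field.absoluteGaloisGroup E) (f : R ι i),
    (RIso ι i (γR ι i σ f)).toLinearMap = (γet σ) ∘ₗ (RIso ι i f).toLinearMap
  /-- ⟨CARRIER⟩ «an automorphic character `ρ_ℓ(π^∞) : E^×\𝔸_E^× → ℂ^×`» (l. 5426), a Hecke character of `E`; meaningful for
  endoscopic cohomological classes; «does not depend on the choice of the isomorphism `ι_ℓ`» (l. 5426). -/
  rhoEll : D.Irr → HeckeCharacter E
  /-- ⟨CARRIER⟩ «It induces, via the isomorphism `ι_ℓ`, an automorphic character» (l. 5426), read backwards: the `ℓ`-adic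
  character `Γ_E → (ℚ_ℓ^{ac})^×` attached via `ι_ℓ` to an automorphic character `ψ` of `E^×\𝔸_E^×` — PINNED by `lAdicOf_spec`
  below whenever `ψ` is algebraic (has an infinity type), which is the only case used (`rhoEll i = μ| |^{−1/2}`, Thm. D.6 (1)). -/
  lAdicOf : (ℂ ≃+* PadicAlgCl ℓ) → HeckeCharacter E → (Field.absoluteGaloisGroup E →* (PadicAlgCl ℓ)ˣ)
  /-- REAL pin of the dictionary, with the Frobenius NORMALISATION made explicit.  [Liu2021, §1.7 «Notation», l. 1135]: «In
  local or global class field theory, the Artin reciprocity map always sends a uniformizer at a nonarchimedean place `v` to a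
  geometric Frobenius element at `v`»; the tree's Artin map `NumberFields.ideleArtinMap E : 𝕀_E → Γ_E^{ab}` ([Shimura1998, §18.3];
  Tate) sends a uniformizer to the ARITHMETIC Frobenius, i.e. `Art_Liu(x) = [x⁻¹, E]`.  For `ψ` of infinity type `(p, q)` its
  `ℓ`-adic avatar `ψ_ℓ = h.lAdicAvatar ι⁻¹ : 𝕀_E →ₜ* (ℚ_ℓ^{ac})^×`, `ψ_ℓ(x) = ι(ψ(x) A_{p,q}(x_∞)⁻¹) · Λ(x)` ([Serre1968, II §2.7],
  [Weil1956]; tree `WeilLAdicCharacterLocalShape`), is the idelic form of «the `ℓ`-adic character inducing `ψ` via `ι_ℓ`»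
  (`ψ_ℓ(ϖ_w) = ι(ψ(ϖ_w))` at `w ∤ ℓ` unramified).  The pin: for every `σ ∈ Γ_E` and idele `x` with `σ|_{E^{ab}} = [x, E]`,
  `lAdicOf ι ψ σ = ψ_ℓ(x)⁻¹` — so that a GEOMETRIC Frobenius at `w` (`= [ϖ_w, E]⁻¹ = Art_Liu(ϖ_w)`) goes to `ι(ψ(ϖ_w))`, as Liu's
  convention demands (and as weight `1` requires: `|ψ(ϖ_w)| = q_w^{1/2}` for `ψ = μ| |^{−1/2}`).
  [cite: Liu2021, §1.7 (l. 1135) and App. D p. 132 (l. 5426)] [cite: SerreAbelianLadic1968, Ch. II §2.7] -/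
  lAdicOf_spec : ∀ (ι : ℂ ≃+* PadicAlgCl ℓ) (ψ : HeckeCharacter E) (p q : NumberField.InfinitePlace E → ℤ)
    (h : ψ.HasInfinityType p q) (σ : Field.absoluteGaloisGroup E) (x : GaloisRepresentations.ideleGroup E),
    GaloisRepresentations.absGaloisAbProj E σ = NumberFields.ideleArtinMap E x →
      lAdicOf ι ψ σ = (h.lAdicAvatar ι.symm x)⁻¹
  /-- REAL pin (l. 5426: «by Proposition D.4, we obtain an `ℓ`-adic character `ρ_{ι_ℓ}(π^∞) : Gal(ℂ/E) → (ℚ_ℓ^{ac})^×. It induces,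
  via the isomorphism `ι_ℓ`, an automorphic character `ρ_ℓ(π^∞)`»): for endoscopic cohomological `i` and every `ι_ℓ`, `Γ_E` acts
  on `H¹_{ι_ℓ}(π^∞)` through the scalar character `lAdicOf ι (rhoEll i)`. -/
  γR_eq_lAdicOf : ∀ (ι : ℂ ≃+* PadicAlgCl ℓ) (i : D.Irr), D.Liu2021_D3_isEndoscopicCohomological i →
    ∀ (σ : Field.absoluteGaloisGroup E) (f : R ι i), γR ι i σ f = ((lAdicOf ι (rhoEll i) σ : (PadicAlgCl ℓ)ˣ) : PadicAlgCl ℓ) • f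
  /-- ⟨CARRIER⟩ a lift `c̃` of the complex conjugation `c` to the algebraic closure `Ē` (for «`ρ^c`», Thm. D.6 (2b)). -/
  cTilde : AlgebraicClosure E ≃+* AlgebraicClosure E
  /-- `c̃` lifts `c`: `c̃|_E = c` (REAL). -/
  cTilde_algebraMap : ∀ x : E, cTilde (algebraMap E (AlgebraicClosure E) x) =
    algebraMap E (AlgebraicClosure E) (AppendixC.conj F E x)
  /-- ⟨CARRIER⟩ the automorphism `σ ↦ c̃ σ c̃⁻¹` of `Γ_E` (READING of «`ρ^c`»: `ρ^c(σ) = ρ(c̃ σ c̃⁻¹)`). -/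
  conjGal : Field.absoluteGaloisGroup E ≃* Field.absoluteGaloisGroup E
  /-- REAL pin: `conjGal σ = c̃ ∘ σ ∘ c̃⁻¹` as maps of `Ē`. -/
  conjGal_apply : ∀ (σ : Field.absoluteGaloisGroup E) (x : AlgebraicClosure E), conjGal σ • x = cTilde (σ • cTilde.symm x)

namespace EllAdic

variable {D}
variable {ℓ : ℕ} [Fact ℓ.Prime] (L : D.EllAdic ℓ)

/-- «`H¹_ét(S̄h(G,h)_K ⊗_E ℂ, ℚ_ℓ^{ac})`» at a (neat open compact) level `K` (l. 5411, 5580) — READING: the `K`-fixed vectors of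
the limit `H¹_ét(S̄h(G,h), ℚ_ℓ^{ac}) = lim_K …` (the transition maps of the smooth system are injective with image the
`K`-invariants), Mathlib `Representation.invariants` of the restriction of `ρet` to `K`; no extra carrier.
[cite: Liu2021, App. D p. 131 (l. 5410–5411)] -/
def H1etLevel (K : Subgroup D.V.Gfin) : Submodule (PadicAlgCl ℓ) L.H1et :=
  Representation.invariants (MonoidHom.comp L.ρet K.subtype : Representation (PadicAlgCl ℓ) K L.H1et)

/-- «`ρ_{ι_ℓ}(π^∞)^∨`» (Thm. D.6 (2b)): the dual representation (Mathlib `Representation.dual`).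
[cite: Liu2021, Thm. D.6 (2b) (p. 132)] -/
def rhoDual (ι : ℂ ≃+* PadicAlgCl ℓ) (i : D.Irr) :
    Representation (PadicAlgCl ℓ) (Field.absoluteGaloisGroup E) (Module.Dual (PadicAlgCl ℓ) (L.R ι i)) :=
  (L.γR ι i).dual

/-- The `ℓ`-adic cyclotomic character of `Γ_E` with values in `(ℚ_ℓ^{ac})^×` (Mathlib `cyclotomicCharacter` on `Aut(Ē)`,
through `Field.absoluteGaloisGroup.toAlgEquiv` of the tree's `AbsGaloisGroup`, composed with `ℤ_ℓ^× → (ℚ_ℓ^{ac})^×`), for the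
Tate twist «`(1)`» of Thm. D.6 (2b). [cite: Liu2021, Thm. D.6 (2b) (p. 132)] -/
def cyclo (_L : D.EllAdic ℓ) (σ : Field.absoluteGaloisGroup E) : (PadicAlgCl ℓ)ˣ :=
  Units.map (algebraMap ℤ_[ℓ] (PadicAlgCl ℓ)).toMonoidHom
    (cyclotomicCharacter (AlgebraicClosure E) ℓ (Field.absoluteGaloisGroup.toAlgEquiv E σ).toRingEquiv)

end EllAdic

/-! ## Theorem D.6 (l. 5433–5459; p. 132 L22–42) -/

/-- «`μ · | |_E^{−1/2}`» (l. 5440): the tree's `IdeleClassGroup.muAlg E μ` ([Liu2021, §4.1 l. 1922], file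
`IdeleClassCharacterAlgebraicTwist`). [cite: Liu2021, Thm. D.6 (1) (p. 132); §4.1 (l. 1922)] -/
def mu1 (t : D.Triple) : HeckeCharacter E := muAlg E (D.tμ t)

/-- «`μ^c χ̌ · | |_E^{−1/2}`» (l. 5441): `(μ ∘ c) · χ̌ · (| |^{1/2})⁻¹` with `μ^c = HeckeCharacter.galConj c μ` (tree
`CMTypeHeckeCharacter`), `χ̌ = chiCheck χ`, `| |^{1/2} = normSqrtCharacter E`. [cite: Liu2021, Thm. D.6 (1) (p. 132); §D.1 (l. 5224)] -/
def mu2 (t : D.Triple) : HeckeCharacter E :=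
  HeckeCharacter.galConj (AppendixC.conj F E) (toHeckeCharacter E (D.tμ t)) * D.chiCheck (D.tχ t) *
    (normSqrtCharacter E)⁻¹

/-- **[Liu2021, Theorem D.6 (1)] EXACTLY AS PRINTED**: «Suppose that `π^∞` is endoscopic cohomological, which is isomorphic to
`ω(μ, ε, χ)` with `μ` of weight one and satisfying `τ'₁ ∈ Φ_μ` as in [Proposition] D.4(1). Then `ρ_ℓ(π^∞) = μ · | |_E^{−1/2}` if
`m_cusp(π_∞^{(1,0)} ⊗ π^∞) = 1`; `ρ_ℓ(π^∞) = μ^c χ̌ · | |_E^{−1/2}` if `m_cusp(π_∞^{(0,1)} ⊗ π^∞) = 1`.»  For the `ℓ`-adic data `L`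
of the prime `ℓ`.  NO PROOF (§D.4: Cor. D.9, [Raj00, Thm. 1], CM theory of the Jacobian — l. 5619–5632; the tree's
`AppendixC/ThmD6CompositionGeneric` composes steps 2–5 abstractly). [cite: Liu2021, Thm. D.6 (1) (p. 132)] -/
def Liu2021_D6_1 {ℓ : ℕ} [Fact ℓ.Prime] (L : D.EllAdic ℓ) : Prop :=
  ∀ (i : D.Irr) (t : D.Triple), D.Liu2021_D3_isEndoscopicCohomological i → D.IsOmega i t → D.IsWeightOneAtTau1 t →
    (D.mCusp10 i = 1 → L.rhoEll i = D.mu1 t) ∧ (D.mCusp01 i = 1 → L.rhoEll i = D.mu2 t)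

/-- **[Liu2021, Theorem D.6 (2a)] EXACTLY AS PRINTED**: for `π^∞` stable cohomological and every `ι_ℓ`, «`ρ_{ι_ℓ}(π^∞)` is an
irreducible two-dimensional representation of `Gal(ℂ/E)`» (READING G1). NO PROOF ([BR93 §4], Cor. D.9, Chebotarev — l. 5621).
[cite: Liu2021, Thm. D.6 (2a) (p. 132)] -/
def Liu2021_D6_2a {ℓ : ℕ} [Fact ℓ.Prime] (L : D.EllAdic ℓ) : Prop :=
  ∀ (i : D.Irr) (ι : ℂ ≃+* PadicAlgCl ℓ), D.Liu2021_D3_isStableCohomological i →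
    Module.finrank (PadicAlgCl ℓ) (L.R ι i) = 2 ∧ (L.γR ι i).IsIrreducible

/-- **[Liu2021, Theorem D.6 (2b)] EXACTLY AS PRINTED**: for `π^∞` stable cohomological and every `ι_ℓ`,
«`ρ_{ι_ℓ}(π^∞)^∨ ≃ ρ_{ι_ℓ}(π^∞)^c(1)`» — READING: there is a `ℚ_ℓ^{ac}`-linear isomorphism `f` from the dual representation
`rhoDual` (Mathlib `Representation.dual`) to the space of `ρ = ρ_{ι_ℓ}(π^∞)` with `f(ρ^∨(σ) φ) = χ_cyc(σ) · ρ(c̃ σ c̃⁻¹)(f φ)`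
for all `σ ∈ Γ_E` (`ρ^c` via `conjGal`, `(1)` = twist by the cyclotomic character `cyclo`). NO PROOF.
[cite: Liu2021, Thm. D.6 (2b) (p. 132)] -/
def Liu2021_D6_2b {ℓ : ℕ} [Fact ℓ.Prime] (L : D.EllAdic ℓ) : Prop :=
  ∀ (i : D.Irr) (ι : ℂ ≃+* PadicAlgCl ℓ), D.Liu2021_D3_isStableCohomological i →
    ∃ f : Module.Dual (PadicAlgCl ℓ) (L.R ι i) ≃ₗ[PadicAlgCl ℓ] L.R ι i,
      ∀ (σ : Field.absoluteGaloisGroup E) (φ : Module.Dual (PadicAlgCl ℓ) (L.R ι i)),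
        f (L.rhoDual ι i σ φ) = ((L.cyclo σ : (PadicAlgCl ℓ)ˣ) : PadicAlgCl ℓ) • L.γR ι i (L.conjGal σ) (f φ)

/-- **[Liu2021, Theorem D.6 (2)]**, the typed part: (2a) ∧ (2b).  Clause (2c) — «`WD(ρ_{ι_ℓ}(π^∞)|Gal(E_w^{ac}/E_w))^{F-ss} ≃
ι_ℓ ∘ 𝓛_{2,E_w}(Π_w^∞ |det|_w^{−1/2})` for every nonarchimedean `w` coprime to `ℓ`, `Π^∞` the standard base change of `π^∞` to
`GL₂(𝔸_E^∞)`» — is NOT TYPED (no local Langlands correspondence for `GL₂(E_w)` / Weil–Deligne functor in the tree); it is quoted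
in the module docstring.  NO PROOF ([BR93 §4], [Car12, Thm. 1.1]). [cite: Liu2021, Thm. D.6 (2) (p. 132)] -/
def Liu2021_D6_2 {ℓ : ℕ} [Fact ℓ.Prime] (L : D.EllAdic ℓ) : Prop :=
  D.Liu2021_D6_2a L ∧ D.Liu2021_D6_2b L

/-! ## The Albanese paragraph, display (D.3), and Corollary D.7 (l. 5463–5494; pp. 133–134) -/

/-- «`𝒞̲_V^{st} := 𝒞_V^{st}/Gal(ℂ/ℚ)`»: the `Gal(ℂ/ℚ)`-orbit `π̲^∞` of a class `i` (l. 5476). [cite: Liu2021, App. D p. 133 (l. 5476)] -/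
def orbit (i : D.Irr) : Set D.Irr := {j | ∃ σ : ℂ ≃ₐ[ℚ] ℂ, D.galAct σ i = j}

/-- «`M(π̲^∞) ⊆ ℂ` its field of definition, namely, the fixed field of the stabilizer of `π̲^∞` in `Gal(ℂ/ℚ)`» (l. 5476): the fixed
field of (the subgroup generated by) the stabilizer of the class `i`; «it is a number field, either totally real or CM» is a
printed claim, not typed. [cite: Liu2021, App. D p. 133 (l. 5476)] -/
def fieldOfDefinition (i : D.Irr) : IntermediateField ℚ ℂ :=
  IntermediateField.fixedField (Subgroup.closure {σ : ℂ ≃ₐ[ℚ] ℂ | D.galAct σ i = i})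

/-- «the dimension of `K`-fixed vectors in a representation in `π̲^∞` …, which we denote by `dim_ℂ(π̲^∞)^K`» (l. 5484), read on the
representative of the class `i` (`fixedSubmodule` of `Def411AsPrinted`); that it «depends only on the orbit» is a printed claim.
[cite: Liu2021, App. D p. 133 (l. 5484)] -/
def dimFixed (K : Subgroup D.V.Gfin) (i : D.Irr) : ℕ := Module.finrank ℂ (fixedSubmodule (D.π i) K)

/-- «`H¹_B(S̄h(G,h)_K, ℂ)[(π^∞)^K]`», the `(π^∞)^K`-isotypic piece at level `K` (l. 5470, 5472) — REAL on the datum: the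
intersection with the `K`-fixed vectors `H¹_B(S̄h(G,h)_K, ℂ) = H¹_B(S̄h(G,h), ℂ)^K` (l. 5359) of the span of the images `f(v)` of
`K`-fixed vectors `v ∈ (π^∞)^K` under `G(𝔸^∞)`-intertwiners `f : π^∞ → H¹_B(S̄h(G,h), ℂ)` (which lie in the `K`-fixed vectors,
`f` being equivariant). [cite: Liu2021, App. D p. 133 (l. 5469–5472)] -/
def isotypic (K : Subgroup D.V.Gfin) (i : D.Irr) : Submodule ℂ (fixedSubmodule D.ρB K) :=
  Submodule.comap (fixedSubmodule D.ρB K).subtype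
    (Submodule.span ℂ {x : D.H1B | ∃ (f : Representation.IntertwiningMap (D.π i) D.ρB) (v : D.W i),
      v ∈ fixedSubmodule (D.π i) K ∧ f v = x})

/-- ⟨CARRIER⟩ **The objects of the Albanese paragraph of [Liu2021, App. D p. 133] (l. 5463–5485)** at a level `K`: the two
factors `A_K^{st}`, `A_K^{end}` of (D.3), the Betti spaces `H¹_B(A_K^{st}, ℂ)`, `H¹_B(A_K^{end}, ℂ)` with the two displayed
identifications onto the (REAL) isotypic pieces `D.isotypic K i = H¹_B(S̄h(G,h)_K, ℂ)[(π^∞)^K]`, the simple abelian varieties `A(π̲^∞)` over `E` (one for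
each class; «associate to `π̲^∞`» — constant on orbits by `A_orbit`), their duals `A(π̲^∞)^∨`, and the relation «have the same
standard base change to `GL₂(𝔸_E^∞)`» of Cor. D.7.  Nothing is asserted; the printed properties are the predicate
`Liu2021_D3display_AsPrinted` and Cor. D.7 below. [cite: Liu2021, App. D p. 133 (l. 5463–5485)] -/
structure AlbaneseD3Data (K : Subgroup D.V.Gfin) : Type 1 where
  /-- ⟨CARRIER⟩ `A_K^{st}` (display (D.3), l. 5465). -/
  Ast : AbelianVariety E
  /-- ⟨CARRIER⟩ `A_K^{end}`, «the endoscopic part of `A_K`» (display (D.3); §4.2 (4.6)). -/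
  Aend : AbelianVariety E
  /-- ⟨CARRIER⟩ `H¹_B(A_K^{st}, ℂ)` (l. 5469). -/
  H1BAst : ModuleCat.{0} ℂ
  /-- ⟨CARRIER⟩ `H¹_B(A_K^{end}, ℂ)` (l. 5471). -/
  H1BAend : ModuleCat.{0} ℂ
  /-- ⟨CARRIER⟩ the first displayed identification «`H¹_B(A_K^{st}, ℂ) ≃ ⊕_{π^∞ ∈ 𝒞_V^{st}} H¹_B(S̄h(G,h)_K, ℂ)[(π^∞)^K]`» (l. 5469–5470),
  «under the canonical isomorphism in Lemma 2.4(1)» (`H¹_B(A_K) ≅ H¹_B(S̄h_K)`), as a `ℂ`-linear equivalence onto the span of the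
  stable isotypic pieces (its `𝒞^∞_c(K\G/K, ℚ)`-equivariance recorded, not typed). -/
  isoSt : H1BAst ≃ₗ[ℂ] (⨆ i ∈ D.Liu2021_D3_CVst, D.isotypic K i : Submodule ℂ (fixedSubmodule D.ρB K))
  /-- ⟨CARRIER⟩ the second displayed identification, for `A_K^{end}` and `𝒞_V^{end}` (l. 5471–5472). -/
  isoEnd : H1BAend ≃ₗ[ℂ] (⨆ i ∈ D.Liu2021_D3_CVend, D.isotypic K i : Submodule ℂ (fixedSubmodule D.ρB K))
  /-- ⟨CARRIER⟩ «a (simple) abelian variety `A(π̲^∞)` over `E`» (l. 5476), indexed by classes. -/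
  A : D.Irr → AbelianVariety E
  /-- `A(π̲^∞)` depends only on the orbit (l. 5476: «associate to `π̲^∞`»). -/
  A_orbit : ∀ (σ : ℂ ≃ₐ[ℚ] ℂ) (i : D.Irr), A (D.galAct σ i) = A i
  /-- ⟨CARRIER⟩ the dual abelian variety «`A(π̲^∞)^∨`» (l. 5482; the tree's duals are `AbelianScheme.DualPair` over
  `AbelianSchemeOver`, docking left to the consumer). -/
  Adual : D.Irr → AbelianVariety E
  /-- ⟨CARRIER⟩ «have the same standard base change to `GL₂(𝔸_E^∞)`» (Cor. D.7, l. 5491), a relation on classes (standard base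
  change is not in the tree). -/
  SameBaseChange : D.Irr → D.Irr → Prop

/-- **[Liu2021, App. D p. 133: display (D.3) and the three bullets] EXACTLY AS PRINTED**, as a predicate on the Albanese data `𝒜`
at a neat open compact level `K`: «we obtain an isogeny decomposition (D.3) `A_K ∼ A_K^{st} × A_K^{end}` (over `E`)» (tree `AbelianVariety.IsIsogenous`,
`AbelianVariety.prod`), and for every stable cohomological class `i` with orbit `π̲^∞` and field of definition `M(π̲^∞)`: `A(π̲^∞)` is
simple, «`dim A(π̲^∞) = [M(π̲^∞):ℚ]`», «`End_E(A(π̲^∞))_ℚ ≃ M(π̲^∞)`» (the tree's `endAlgebra = ℚ ⊗_ℤ End`, as `ℚ`-algebras), and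
«`A(π̲^∞) ⊗_{E,c} E` is isogenous to `A(π̲^∞)^∨`» (`AbelianVariety.conjugate c`).  «By Theorem D.6(2) and a standard argument»: NO
PROOF; «of strict `GL(2)`-type [YZZ13, §3.2.1]» not typed. [cite: Liu2021, App. D p. 133 (l. 5463–5485), display (D.3)] -/
def Liu2021_D3display_AsPrinted (K : Subgroup D.V.Gfin) (hn : D.S.IsNeat K) (hK : IsOpenCompact K)
    (𝒜 : D.AlbaneseD3Data K) : Prop :=
  AbelianVariety.IsIsogenous (D.jac K hn hK).J (𝒜.Ast.prod 𝒜.Aend) ∧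
  ∀ i ∈ D.Liu2021_D3_CVst,
    AbelianVariety.IsSimple (𝒜.A i) ∧
    (𝒜.A i).dim = Module.finrank ℚ (D.fieldOfDefinition i) ∧
    Nonempty ((𝒜.A i).endAlgebra ≃ₐ[ℚ] D.fieldOfDefinition i) ∧
    AbelianVariety.IsIsogenous ((𝒜.A i).conjugate (AppendixC.conj F E).toRingEquiv) (𝒜.Adual i)

/-- «factors that are of CM type» (Cor. D.7; Liu does not define the notion): an abelian variety `B` over `E` is OF CM TYPE
when `End⁰(B) = B.endAlgebra` contains a commutative reduced `ℚ`-subalgebra `S` with `dim_ℚ S = 2 dim B` — VERBATIM the tree's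
`Literature.AlgebraicGeometry.Milne1999.IsOfCMType` (file `Milne1999/HodgeCMImpliesTateFiniteFields`, stated there for
`AbelianVariety ℂ`) with the base field `ℂ` replaced by `E`; for simple `B` it agrees with `Milne1999.IsOfCMTypeSimple`
(`End⁰(B)` a field of degree `2 dim B`).  Named `IsOfCMTypeOver` so as not to overload the tree's name.
[cite: Milne1999, §2 p. 54] [cite: Deligne1982HodgeCycles, §5 Prop. 5.1] -/
def IsOfCMTypeOver (B : AbelianVariety E) : Prop :=
  ∃ S : Subalgebra ℚ B.endAlgebra,
    IsReduced ↥S ∧ (∀ x ∈ S, ∀ y ∈ S, x * y = y * x) ∧ Module.finrank ℚ ↥S = 2 * B.dim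

/-- The product of a list of abelian varieties over `E` by iterated binary products (tree `AbelianVariety.prod`; `none` for
the empty list): the finite products `∏ A(π̲^∞)^{dim(π̲^∞)^K}` of Cor. D.7, read up to isomorphism (order and bracketing are
immaterial up to isomorphism, a fortiori up to isogeny). Our bookkeeping. [cite: Liu2021, Cor. D.7 (p. 133)] -/
def listProd (l : List (AbelianVariety E)) : Option (AbelianVariety E) :=
  l.foldr (fun B acc => some (acc.elim B fun P => B.prod P)) none

/-- **[Liu2021, Corollary D.7] EXACTLY AS PRINTED** (typed part), at a level `K` with Albanese data `𝒜`:
«we have an isogeny decomposition `A_K^{st} ∼ ∏_{π̲^∞ ∈ 𝒞̲_V^{st}} A(π̲^∞)^{dim_ℂ(π̲^∞)^K}`» — READING: there are a finite set `T`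
of representatives of the `Gal(ℂ/ℚ)`-orbits of stable cohomological classes with `(π^∞)^K ≠ 0` (exactly one per such orbit) and
`A_K^{st}` is isogenous to the product (`listProd`) of the list in which each `A(i)`, `i ∈ T`, occurs `dim_ℂ(π_i)^K` times
(`T.toList.flatMap (replicate …)`; empty product: `dim A_K^{st} = 0`); «In particular, `A_K^{st}` does not have
factors that are of CM type» — READING: no `A(π̲^∞)`, `π̲^∞ ∈ 𝒞̲_V^{st}`, is of CM type (`IsOfCMTypeOver`, the tree's `Milne1999.IsOfCMType` over `E`); «Moreover, `A(π̲₁^∞)` is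
isogenous to `A(π̲₂^∞)` for `π̲₁^∞, π̲₂^∞ ∈ 𝒞̲_V^{st}` if and only if there exist `π₁^∞ ∈ π̲₁^∞` and `π₂^∞ ∈ π̲₂^∞` that have the same
standard base change to `GL₂(𝔸_E^∞)`» over the posited relation `SameBaseChange`.  «for every sufficiently small open compact
subgroup `K`» and «compatible with changing `K` in the obvious way» are the consumer's quantification over its levels (not
typed).  NO PROOF. [cite: Liu2021, Cor. D.7 (p. 133)] -/
def Liu2021_D7 (K : Subgroup D.V.Gfin) (𝒜 : D.AlbaneseD3Data K) : Prop :=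
  (∃ T : Finset D.Irr, (↑T ⊆ D.Liu2021_D3_CVst) ∧ (∀ j ∈ T, 0 < D.dimFixed K j) ∧
      (∀ i ∈ D.Liu2021_D3_CVst, 0 < D.dimFixed K i → ∃! j, j ∈ T ∧ j ∈ D.orbit i) ∧
      (listProd (T.toList.flatMap fun i => List.replicate (D.dimFixed K i) (𝒜.A i))).elim
        (𝒜.Ast.dim = 0) (fun P => AbelianVariety.IsIsogenous 𝒜.Ast P)) ∧
  (∀ i ∈ D.Liu2021_D3_CVst, ¬ IsOfCMTypeOver (𝒜.A i)) ∧
  (∀ i₁ ∈ D.Liu2021_D3_CVst, ∀ i₂ ∈ D.Liu2021_D3_CVst,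
    AbelianVariety.IsIsogenous (𝒜.A i₁) (𝒜.A i₂) ↔ ∃ j₁ ∈ D.orbit i₁, ∃ j₂ ∈ D.orbit i₂, 𝒜.SameBaseChange j₁ j₂)


end SecD3Data

end Literature.NumberTheory.Automorphic.Liu2021.AppendixD.SecD3CohomologyUnitaryCurves

end
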